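/-
Copyright (c) 2026 the pub-hodgecm-mathlib formalisation cell (harness21).  Prover seat hodgecm-mathlib-LH4-p11 (g9), req620 Track A «(D-RAM) FOUR-FRAME» squad, helper lane on
h413 = stmt-HodgeConjecture-24833 (count-neutral).  β-BOARD v1 (sub-dealer LH4-p05 (g8) LEDGER #13) ROW R6a «THE PER-LATTICE κ-CLASS READ OF TOWER 1» (strata `![2ρ, 2ρ+s, 2ρ+s]`
at the κ-locus `2ρ + ℓ₀ = n₂`) — the glued representative's label as SIGN × CHARACTER; inputs ★ p13 (L-lab-20c), ★ LH4-p17 (g0) R3 FILE 3, adapted from them.  2026-09-04.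
-/
import Summits.HodgeConjecture.HodgeConjecture.Theorems.F0P3cDyRamTwoSlotLabelReadGlued       -- ★ (LH4-p13 (g8), (L-lab-20c)): `valueClassLabel_glued_rep_class_iff_normSign`
import Summits.HodgeConjecture.HodgeConjecture.Theorems.F0P3cDyRamLabelledOddGluedCharacter    -- ★ (LH4-p17 (g0), R3 FILE 3): `ratios_of_mem_fixedUnitStabilizer_glued_rep`; brings ★ `mem_fixedUnitStabilizer_glued_rep_iff`, ★ ω-conductor toolkit (`normSign_mul_of_fixed`)
import Summits.HodgeConjecture.HodgeConjecture.Theorems.F0P3cDyRamStageOneBDefs                -- ★ DEFS №5: `mcOfRecord`; brings `mstarOfRecord`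
import HarnessLib

/-!
# Crux `H413`, line LH4 «(D-RAM) FOUR-FRAME» — (β-BAL) Stage B, β-BOARD ROW R6a «THE κ-CLASSES OF TOWER 1, PER LATTICE»: on the glued representative `latt V(1,1,g)` of a
# κ-class stratum `G₁(ρ, s) = (2ρ, 2ρ+s, 2ρ+s)` (`2ρ + ℓ₀ = n₂`, below the read `n₂ + s < n₁`) the value-class label of the class `D(g)·u` is `ε(g) · μ_c(u)`,
# `ε(g) = ω(g·e_A·(1 + r))`, `μ_c(u) = ω(u₀)·ω(1 + c·(u₁∕u₀ − 1))`, with `r = e_B·π₀^{t′+k}∕(g·e_A)` of depth `2k = n₁ − n₂ − s` and `c = r∕(1+r)`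

Cell `hodgecm-mathlib` (D-0151), FLOOR 0, crux item H413 = `stmt-HodgeConjecture-24833`, route `HCCMUnconditional`; squad F0∕P3c∕LH4.  THEOREMS ONLY (no `def`, no instance, no
notation, no `sorry`, default heartbeats); ★-only imports; lane `--supports stmt-HodgeConjecture-24833 --as helper` (count-neutral); pays NO row, states NO law.
THE MATHEMATICS (LH4-cdis1 (g0) KAPPA-CLASS-RULE v1 9469d3b1, sub-dealer ruling 15:27:19Z; this is the lattice half R6a, the sum R6b is LH4-p08 (g10)'s).  The κ-CLASSES of the
special tower `X* = 1` (`n₂ = n₃ = m < n₁ = m + s_g`) are the glued strata `G₁(ρ, s)`, `s = 2t′`, with `2ρ + ℓ₀ = m = n₂` and `2 ≤ s ≤ s_g − 2`; each orbit has the glued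
representative `V(1,1,g) = (1 0 0; 1 ϖ^ρ 0; 1+g ϖ^ρ ϖ^{2ρ+2t′})`, `|g| = |ϖ|^{2t′}`, with LH4-p09's ★ polarisation `D(g) = π₀^{−(ρ+t′)}·(g, 1, −(1+g)⁻¹)` and classes `D(g)·u`
(`u` σ-fixed units).  ★ p13 `valueClassLabel_glued_rep_class_iff_normSign` reads the label of `D(g)·u` as `ω(u₀·g·g_α + u₁·g_β)` for any fixed approximants `g_α, g_β` of
`(α−1)∕t₊`, `(β−1)∕t₊` to the precisions `|ϖ^{−m*}·D(g)₀u₀·((α−1) − g_α t₊)| ≤ 1`, `|ϖ^{−m*}·D(g)₁u₁·((β−1) − g_β t₊)| ≤ 1`.  AT THE κ-LOCUS take `g_α = e_A·π₀^ρ`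
(the tower-sign token of `α − 1` at exponent `ρ`: `2ρ + ℓ₀ = n₂`) and `g_β = e_B·π₀^{ρ+t′+k}` (token of `β − 1` at `ρ + t′ + k`, `2(ρ+t′+k) + ℓ₀ = n₁`, `k ≥ 1`): both
precisions hold with EQUALITY resp. to spare (`|π₀^{ρ−ρ−t′}·g| = 1`, `|π₀^{k}| ≤ 1`) — §2 HEAD **`valueClassLabel_glued_rep_class_kappaLocus_iff`**:
`valueClassLabel … (latt V) (D(g)·u) ↔ ω(u₀·g·e_A·π₀^ρ + u₁·e_B·π₀^{ρ+t′+k}) = 1`.  In R3 (beyond the cell, ON the read `2ρ + s + ℓ₀ = n₁`) the `g_β`-term leads and `g·g_α` is the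
twist (★ R3 FILE 3 `normSign_twoSlot_factor`); AT THE κ-LOCUS THE RÔLES ARE EXCHANGED: `|u₀·g·e_A·π₀^ρ| = |ϖ|^{2t′+2ρ}` LEADS and `|u₁·e_B·π₀^{ρ+t′+k}| = |ϖ|^{2ρ+2t′+2k}` is the
twist of depth `2k = n₁ − n₂ − s` (`= s_g − s` for the special tower — LH4-cdis1's `F(n_{X*} − m − s)` argument) — §1 **`normSign_twoSlot_factor_fst`**: for fixed `G₀ ≠ 0` and
`|r| < 1`, `ω(u₀·G₀ + u₁·(r·G₀)) = ω(G₀(1+r)) · (ω(u₀)·ω(1 + r∕(1+r)·(u₁∕u₀ − 1)))`, whence §2 **`valueClassLabel_glued_rep_class_kappaLocus_iff_character`**: the label of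
`D(g)·u` is `ε(g)·μ_c(u) = 1` with the ORBIT SIGN `ε(g) = ω(g·e_A·π₀^ρ·(1+r)) = ω(g·e_A·(1+r))` (`π₀^ρ = N(ϖ^ρ)` leaves `ω`) and the CHARACTER
`μ_c(u) = ω(u₀)·ω(1 + c·(u₁∕u₀ − 1))`, `r = e_B·π₀^{t′+k}∕(g·e_A)` (`|r| = |ϖ|^{2k}`), `c = r∕(1+r)`.  On `S_F(latt V)` one has `u₀∕u₁ ∈ U^{[ρ]}` (★ LH4-p17
`ratios_of_mem_fixedUnitStabilizer_glued_rep`), so `μ_c` is LH4-p17's `λ` with the slots `0 ↔ 1` exchanged: under the involution `u ↦ u⁻¹` of `S_F` the indicator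
`[∀ u ∈ S_F, ω(u₀)·μ_c(u) = 1] = [∀ u, ω(1 + c(u₀∕u₁ − 1)) = 1]` is ★ `forall_normSign_one_mul_gluedChar_iff`'s (`= [2d ≤ ρ + 2k + 1]`) and `[∀ u, ω(u₁)·μ_c(u) = 1]` is
★ `forall_normSign_zero_mul_gluedChar_iff`'s (`= [2d ≤ ρ + 1]`) — the sum half's business (R6b), together with the `g`-transversal sum of the orbit signs `ε(g)` (own slot `0`:
`ω(D(g)₀)·ε(g) = ω(e_A)·ω(1 + r(g))`, `|r(g)| = |ϖ|^{s_g − s}` ⇒ LH4-cdis1's boundary factor `F(s_g − s)` by ★ B3 sums).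
HONEST LABEL.  Count-neutral (`--supports`); nothing printed is asserted; R6b (the orbit∕stratum∕family sums), hRest, the table identity, (β-BAL), (β) `stub_law_cleanSgn`, T₊ remain
OPEN; `HC_CM` is proved only modulo the 7 printed citations (2 remaining named inputs: hLiu418 = `stmt-HodgeConjecture-24832`, h413 = `stmt-HodgeConjecture-24833`) until rung 0 closes.
References: [Kottwitz1986BaseChangeUnits] §1 pp. 240–241 · [Rogawski1990] §4.9 Prop. 4.9.1 (a)(b) p. 55, §4.10 p. 58 · [LanglandsShelstad1987] §3 · [Serre1979] Ch. V §3 Cor. 3, Ch. XV §2.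
-/

set_option autoImplicit false

noncomputable section

namespace Summit.HodgeConjecture.HodgeConjecture.Cruxes.H413.F0P3cDyRamLabelledOddKappaClassGluedRep

open Matrix WithZero
open Literature.NumberTheory.Automorphic Literature.NumberTheory.Automorphic.HermitianLattice Literature.NumberTheory.Automorphic.UnitaryGroup
open Literature.NumberTheory.Automorphic.UnitaryLatticeTree Literature.NumberTheory.Automorphic.UnitaryThreeFourFrame
open Literature.NumberTheory.LocalFields Literature.NumberTheory.LocalFields.WildQuadraticDatum
open Summit.HodgeConjecture.HodgeConjecture.Cruxes.H413.F0P3cDyRamFourFramePieces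
open Summit.HodgeConjecture.HodgeConjecture.Cruxes.H413.F0P3cDyRamFourFrameCensusDefs
open Summit.HodgeConjecture.HodgeConjecture.Cruxes.H413.F0P3cDyRamStageOneBDefs (mcOfRecord)
open Summit.HodgeConjecture.HodgeConjecture.Cruxes.H413.F0P3cDyRamDiagonalTorusDefs
open Summit.HodgeConjecture.HodgeConjecture.Cruxes.H413.F0P3cDyRamLabelledOddCountDefs (valueClassLabel)
open Summit.HodgeConjecture.HodgeConjecture.Cruxes.H413.F0P3cDyRamFixedCountDiagonalModel (normSign_mul_norm)
open Summit.HodgeConjecture.HodgeConjecture.Cruxes.H413.F0P3cDyRamTwoSlotLabelReadGlued (valueClassLabel_glued_rep_class_iff_normSign)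
open Summit.HodgeConjecture.HodgeConjecture.Cruxes.H413.F0P3cDyRamLabelledOddGluedCharacter (ratios_of_mem_fixedUnitStabilizer_glued_rep)
open scoped Valued WithZero Matrix MatrixGroups

variable {K : Type} [Field K] [Valued K ℤᵐ⁰]

/-! ## §1  The two-slot linear form with the FIRST slot leading: SIGN × CHARACTER -/

/-- **`ω(u₀·G₀ + u₁·(r·G₀)) = ω(G₀(1+r)) · (ω(u₀)·ω(1 + r∕(1+r)·(u₁∕u₀ − 1)))`** for fixed `G₀ ≠ 0`, fixed `r` with `|r| < 1`, `u` in the fixed unit torus and `|r∕(1+r)·(u₁∕u₀ − 1)| < 1`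
— the EXACT identity `u₀·G₀ + u₁·r·G₀ = G₀(1+r)·u₀·(1 + r∕(1+r)·(u₁∕u₀ − 1))` and multiplicativity of `ω` on fixed non-zero elements (★ `normSign_mul_of_fixed`).  The twin of ★ R3 FILE 3
`normSign_twoSlot_factor` with the leading slot `0` instead of `1`. [cite: Rogawski1990, §4.9 Prop. 4.9.1 (b) p. 55] [cite: Serre1979, Ch. V §3 Cor. 3] -/
theorem normSign_twoSlot_factor_fst [CompleteSpace K] [Finite 𝓀[K]] {σ : K →+* K} {ϖ : K} {d t : ℕ} (hD : IsRamifiedQuadraticDatum σ ϖ d t)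
    {G₀ r : K} (hσG₀ : σ G₀ = G₀) (hσr : σ r = r) (hG₀ : G₀ ≠ 0) (hr : Valued.v r < 1) {u : Fin 3 → Kˣ} (hu : u ∈ fixedUnitTorus σ 3)
    (hv : Valued.v (r / (1 + r) * (((u 1 : Kˣ) : K) / ((u 0 : Kˣ) : K) - 1)) < 1) :
    normSign σ (((u 0 : Kˣ) : K) * G₀ + ((u 1 : Kˣ) : K) * (r * G₀)) =
      normSign σ (G₀ * (1 + r)) * (normSign σ ((u 0 : Kˣ) : K) * normSign σ (1 + r / (1 + r) * (((u 1 : Kˣ) : K) / ((u 0 : Kˣ) : K) - 1))) := by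
  obtain ⟨hu1, hu2⟩ := (mem_fixedUnitTorus_iff σ u).1 hu
  have h0 : ∀ j, ((u j : Kˣ) : K) ≠ 0 := fun j => (u j).ne_zero
  have h1r : Valued.v (1 + r) = 1 := Valued.v.map_one_add_of_lt hr
  have h1r0 : (1 : K) + r ≠ 0 := fun h => by rw [h, map_zero] at h1r; exact zero_ne_one h1r
  have hw : Valued.v (1 + r / (1 + r) * (((u 1 : Kˣ) : K) / ((u 0 : Kˣ) : K) - 1)) = 1 := Valued.v.map_one_add_of_lt hv
  have hw0 : (1 : K) + r / (1 + r) * (((u 1 : Kˣ) : K) / ((u 0 : Kˣ) : K) - 1) ≠ 0 := fun h => by rw [h, map_zero] at hw; exact zero_ne_one hw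
  have e1 : (1 + r) * (1 + r / (1 + r) * (((u 1 : Kˣ) : K) / ((u 0 : Kˣ) : K) - 1)) = 1 + r * (((u 1 : Kˣ) : K) / ((u 0 : Kˣ) : K)) := by
    rw [mul_add, mul_one, ← mul_assoc, mul_div_cancel₀ _ h1r0]; ring
  have hv0 : ((u 0 : Kˣ) : K) * (((u 1 : Kˣ) : K) / ((u 0 : Kˣ) : K)) = ((u 1 : Kˣ) : K) := by field_simp
  have e : ((u 0 : Kˣ) : K) * G₀ + ((u 1 : Kˣ) : K) * (r * G₀) =
      (G₀ * (1 + r)) * (((u 0 : Kˣ) : K) * (1 + r / (1 + r) * (((u 1 : Kˣ) : K) / ((u 0 : Kˣ) : K) - 1))) := by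
    rw [show (G₀ * (1 + r)) * (((u 0 : Kˣ) : K) * (1 + r / (1 + r) * (((u 1 : Kˣ) : K) / ((u 0 : Kˣ) : K) - 1))) =
        G₀ * ((u 0 : Kˣ) : K) * ((1 + r) * (1 + r / (1 + r) * (((u 1 : Kˣ) : K) / ((u 0 : Kˣ) : K) - 1))) by ring, e1, mul_add, mul_one,
      show G₀ * ((u 0 : Kˣ) : K) * (r * (((u 1 : Kˣ) : K) / ((u 0 : Kˣ) : K))) = r * G₀ * (((u 0 : Kˣ) : K) * (((u 1 : Kˣ) : K) / ((u 0 : Kˣ) : K))) by ring, hv0]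
    ring
  have hσA : σ (G₀ * (1 + r)) = G₀ * (1 + r) := by rw [map_mul, hσG₀, map_add, map_one, hσr]
  have hσw : σ (1 + r / (1 + r) * (((u 1 : Kˣ) : K) / ((u 0 : Kˣ) : K) - 1)) = 1 + r / (1 + r) * (((u 1 : Kˣ) : K) / ((u 0 : Kˣ) : K) - 1) := by
    rw [map_add, map_one, map_mul, map_div₀, hσr, map_add, map_one, hσr, map_sub, map_one, map_div₀, hu2, hu2]
  rw [e, normSign_mul_of_fixed hD hσA (by rw [map_mul, hu2, hσw]) (mul_ne_zero hG₀ h1r0) (mul_ne_zero (h0 0) hw0),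
    normSign_mul_of_fixed hD (hu2 0) hσw (h0 0) hw0]

/-! ## §2  HEAD — the label of the class `D(g)·u` on `latt V(1,1,g)` at the κ-locus -/

section KappaLocus

variable [CompleteSpace K] {σ : K →+* K} {ϖ : K} {d t : ℕ} {α β : K} {N₀ n₁ n₂ n₃ : ℕ}

/-- **THE LABEL ON `latt V(1,1,g)` AT THE κ-LOCUS, LINEAR FORM** (`ρ, t′ ≥ 1`, `|g| = |ϖ|^{2t′}`, `g` fixed; κ-locus `2ρ + ℓ₀ = n₂`; below the read: `2(ρ+t′+k) + ℓ₀ = n₁` with `k ≥ 1`;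
element datum at `N₀ ≥ mcOfRecord d`, `2 ≤ d`; `latt V` `T`-stable, on the clean shell; `u` σ-fixed units with `diag(D(g)·u)` a type-0 polarisation; tokens `e_A` of `α − 1` at `ρ` and `e_B` of
`β − 1` at `ρ + t′ + k`): `valueClassLabel σ ϖ (α−1) (β−1) m* d (latt V) (D(g)·u) ↔ normSign σ (u₀·g·(e_A·π₀^ρ) + u₁·(e_B·π₀^{ρ+t′+k})) = 1` (★ p13 (L-lab-20c) class read with
`g_α = e_A·π₀^ρ`, `g_β = e_B·π₀^{ρ+t′+k}`; the precisions are `|g·π₀^{−t′}| = 1` and `|π₀^{k}| ≤ 1` times the token letters). [cite: Rogawski1990, §4.9 Prop. 4.9.1 (b) p. 55]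
[cite: Serre1979, Ch. V §3 Cor. 3] [cite: Kottwitz1986BaseChangeUnits, §1 pp. 240–241] -/
theorem valueClassLabel_glued_rep_class_kappaLocus_iff (hDat : IsRamifiedQuadraticDatum σ ϖ d t) (h2d : 2 ≤ d)
    {ρ t' : ℕ} (hρ : 1 ≤ ρ) (ht' : 1 ≤ t') {g : K} (hσg : σ g = g) (hg : Valued.v g = Valued.v ϖ ^ (2 * t'))
    (V : GL (Fin 3) K) (hV : (V : Matrix (Fin 3) (Fin 3) K) = !![1, 0, 0; 1, ϖ ^ ρ, 0; 1 * 1 + g, ϖ ^ ρ * 1, ϖ ^ (2 * ρ + 2 * t')])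
    {u : Fin 3 → K} (hσu : ∀ i, σ (u i) = u i) (hu0 : ∀ i, u i ≠ 0) (hu1 : ∀ i, Valued.v (u i) = 1)
    (hn : IsNormalisedLattice (latt (V : Matrix (Fin 3) (Fin 3) K)))
    (hM : IsVertexLattice σ ϖ (Matrix.diagonal fun j => (![((ϖ * σ ϖ) ^ (ρ + t'))⁻¹ * g, ((ϖ * σ ϖ) ^ (ρ + t'))⁻¹, -(((ϖ * σ ϖ) ^ (ρ + t'))⁻¹ * (1 + g)⁻¹)] : Fin 3 → K) j * u j) 0
      (latt (V : Matrix (Fin 3) (Fin 3) K)))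
    (hE : IsElementDatum σ ϖ N₀ α β n₁ n₂ n₃) (hmc : mcOfRecord d ≤ N₀)
    (hlev : LatticeInLevel ϖ (d % 2) (Matrix.diagonal ![α - 1, β - 1, 0]) (latt (V : Matrix (Fin 3) (Fin 3) K)))
    (hnlev : ¬ LatticeInLevel ϖ (d % 2 + 1) (Matrix.diagonal ![α - 1, β - 1, 0]) (latt (V : Matrix (Fin 3) (Fin 3) K)))
    (hsq : LatticeInLevel ϖ (mcOfRecord d) (Matrix.diagonal ![(α - 1) * (α - 1), (β - 1) * (β - 1), 0]) (latt (V : Matrix (Fin 3) (Fin 3) K)))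
    {T : GL (Fin 3) K} (hT : (T : Matrix (Fin 3) (Fin 3) K) = Matrix.diagonal ![α, β, 1]) (hTM : mapGL T (latt (V : Matrix (Fin 3) (Fin 3) K)) = latt (V : Matrix (Fin 3) (Fin 3) K))
    (hκ : 2 * ρ + d % 2 = n₂) (k : ℕ) (hk : 1 ≤ k) (hk₁ : 2 * (ρ + t' + k) + d % 2 = n₁)
    {eA : K} (hσeA : σ eA = eA)
    (heA : Valued.v ((ϖ ^ (d % 2 + 2 * d - 1))⁻¹ * ((α - 1) * ((ϖ * σ ϖ) ^ ρ)⁻¹ - eA * ((ϖ - σ ϖ) * ((ϖ * σ ϖ) ^ ((d - d % 2) / 2))⁻¹))) ≤ 1)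
    {eB : K} (hσeB : σ eB = eB)
    (heB : Valued.v ((ϖ ^ (d % 2 + 2 * d - 1))⁻¹ * ((β - 1) * ((ϖ * σ ϖ) ^ (ρ + t' + k))⁻¹ - eB * ((ϖ - σ ϖ) * ((ϖ * σ ϖ) ^ ((d - d % 2) / 2))⁻¹))) ≤ 1) :
    valueClassLabel σ ϖ (α - 1) (β - 1) (d % 2 + 2 * d - 1) d (latt (V : Matrix (Fin 3) (Fin 3) K))
        (fun j => (![((ϖ * σ ϖ) ^ (ρ + t'))⁻¹ * g, ((ϖ * σ ϖ) ^ (ρ + t'))⁻¹, -(((ϖ * σ ϖ) ^ (ρ + t'))⁻¹ * (1 + g)⁻¹)] : Fin 3 → K) j * u j) ↔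
      normSign σ (u 0 * g * (eA * (ϖ * σ ϖ) ^ ρ) + u 1 * (eB * (ϖ * σ ϖ) ^ (ρ + t' + k))) = 1 := by
  obtain ⟨hσ, hvσ, hϖ, -, -, -, -⟩ := id hDat
  have hϖ0 : ϖ ≠ 0 := (Valuation.ne_zero_iff Valued.v).1 (by rw [hϖ]; exact exp_ne_zero)
  have hϖ1 : Valued.v ϖ < 1 := by rw [hϖ, ← exp_zero, exp_lt_exp]; norm_num
  have hσϖ0 : σ ϖ ≠ 0 := (map_ne_zero σ).2 hϖ0
  have hg0 : g ≠ 0 := fun h => by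
    rw [h, map_zero] at hg; exact (pow_ne_zero _ ((Valuation.ne_zero_iff _).2 hϖ0)) hg.symm
  have hglt : Valued.v g < 1 := by rw [hg]; exact pow_lt_one₀ zero_le hϖ1 (by omega)
  have hπ₀σ : σ (ϖ * σ ϖ) = ϖ * σ ϖ := by rw [map_mul, hσ, mul_comm]
  have hπσ : ∀ m : ℕ, σ ((ϖ * σ ϖ) ^ m) = (ϖ * σ ϖ) ^ m := fun m => by rw [map_pow, hπ₀σ]
  have hπne : ∀ m : ℕ, ((ϖ * σ ϖ) ^ m : K) ≠ 0 := fun m => pow_ne_zero _ (mul_ne_zero hϖ0 hσϖ0)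
  have hvπ : ∀ m : ℕ, Valued.v ((ϖ * σ ϖ) ^ m) = exp (-((2 * m : ℕ) : ℤ)) := fun m => by
    rw [map_pow, map_mul, hvσ, ← pow_two, ← pow_mul, v_varpi_pow hϖ]
  have hq : ∀ m : ℕ, Valued.v ϖ ^ m = exp (-(m : ℤ)) := fun m => v_varpi_pow hϖ m
  have hN₁ : N₀ ≤ n₁ := hE.2.2.2.2.2.2.2.2.1
  have hN₂ : N₀ ≤ n₂ := hE.2.2.2.2.2.2.2.2.2.1
  have hmcv : mcOfRecord d = 2 * ((d % 2 + 2 * d - 1 + d) / 2) := rfl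
  -- the precisions of the two approximants `g_α = e_A·π₀^ρ`, `g_β = e_B·π₀^{ρ+t′+k}`
  have hgα : Valued.v ((ϖ ^ (d % 2 + 2 * d - 1))⁻¹ * (((ϖ * σ ϖ) ^ (ρ + t'))⁻¹ * g * u 0 *
      ((α - 1) - eA * (ϖ * σ ϖ) ^ ρ * ((ϖ - σ ϖ) * ((ϖ * σ ϖ) ^ ((d - d % 2) / 2))⁻¹)))) ≤ 1 := by
    have e : (ϖ ^ (d % 2 + 2 * d - 1))⁻¹ * (((ϖ * σ ϖ) ^ (ρ + t'))⁻¹ * g * u 0 *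
        ((α - 1) - eA * (ϖ * σ ϖ) ^ ρ * ((ϖ - σ ϖ) * ((ϖ * σ ϖ) ^ ((d - d % 2) / 2))⁻¹))) =
        (((ϖ * σ ϖ) ^ (ρ + t'))⁻¹ * (ϖ * σ ϖ) ^ ρ * g * u 0) *
          ((ϖ ^ (d % 2 + 2 * d - 1))⁻¹ * ((α - 1) * ((ϖ * σ ϖ) ^ ρ)⁻¹ - eA * ((ϖ - σ ϖ) * ((ϖ * σ ϖ) ^ ((d - d % 2) / 2))⁻¹))) := by
      field_simp
    have hc : Valued.v (((ϖ * σ ϖ) ^ (ρ + t'))⁻¹ * (ϖ * σ ϖ) ^ ρ * g * u 0) = 1 := by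
      rw [map_mul, map_mul, map_mul, map_inv₀, hvπ, hvπ, hg, hq, hu1 0, mul_one, ← WithZero.exp_neg, ← exp_add, ← exp_add, ← exp_zero]
      congr 1; push_cast; ring
    rw [e, map_mul, hc, one_mul]
    exact heA
  have hgβ : Valued.v ((ϖ ^ (d % 2 + 2 * d - 1))⁻¹ * (((ϖ * σ ϖ) ^ (ρ + t'))⁻¹ * u 1 *
      ((β - 1) - eB * (ϖ * σ ϖ) ^ (ρ + t' + k) * ((ϖ - σ ϖ) * ((ϖ * σ ϖ) ^ ((d - d % 2) / 2))⁻¹)))) ≤ 1 := by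
    have e : (ϖ ^ (d % 2 + 2 * d - 1))⁻¹ * (((ϖ * σ ϖ) ^ (ρ + t'))⁻¹ * u 1 *
        ((β - 1) - eB * (ϖ * σ ϖ) ^ (ρ + t' + k) * ((ϖ - σ ϖ) * ((ϖ * σ ϖ) ^ ((d - d % 2) / 2))⁻¹))) =
        (((ϖ * σ ϖ) ^ (ρ + t'))⁻¹ * (ϖ * σ ϖ) ^ (ρ + t' + k) * u 1) *
          ((ϖ ^ (d % 2 + 2 * d - 1))⁻¹ * ((β - 1) * ((ϖ * σ ϖ) ^ (ρ + t' + k))⁻¹ - eB * ((ϖ - σ ϖ) * ((ϖ * σ ϖ) ^ ((d - d % 2) / 2))⁻¹))) := by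
      field_simp
    have hc : Valued.v (((ϖ * σ ϖ) ^ (ρ + t'))⁻¹ * (ϖ * σ ϖ) ^ (ρ + t' + k) * u 1) ≤ 1 := by
      rw [map_mul, map_mul, map_inv₀, hvπ, hvπ, hu1 1, mul_one, ← WithZero.exp_neg, ← exp_add, ← exp_zero, exp_le_exp]
      push_cast; omega
    rw [e, map_mul]
    exact mul_le_one' hc heB
  have h := valueClassLabel_glued_rep_class_iff_normSign hDat hρ hglt hg0 V hV hσg hσu hu0 hn hM hE (mc := mcOfRecord d)
    (by omega) (by omega) (by rw [hmcv]; omega) (by rw [hmcv]; omega) hlev hnlev hsq hT hTM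
    (gα := eA * (ϖ * σ ϖ) ^ ρ) (gβ := eB * (ϖ * σ ϖ) ^ (ρ + t' + k))
    (by rw [map_mul, hσeA, hπσ]) (by rw [map_mul, hσeB, hπσ]) hgα hgβ
  rw [h]

/-- **HEAD — THE LABEL ON `latt V(1,1,g)` AT THE κ-LOCUS IS `ε(g)·μ_c(u)`**: under the hypotheses of `valueClassLabel_glued_rep_class_kappaLocus_iff`, for `u` in the fixed unit torus with
`|u₁∕u₀ − 1| ≤ |ϖ|^ρ` (every `u ∈ S_F(latt V)`: ★ `ratios_of_mem_fixedUnitStabilizer_glued_rep`), with `r := e_B·π₀^{t′+k}∕(g·e_A)` (`|r| = |ϖ|^{2k} < 1`, `e_A, e_B` fixed units):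
`valueClassLabel … (latt V) (D(g)·u) ↔ ω(g·e_A·(1+r)) · (ω(u₀)·ω(1 + r∕(1+r)·(u₁∕u₀ − 1))) = 1` — the ORBIT SIGN `ε(g) = ω(g·e_A·(1+r))` times the CHARACTER
`μ_c(u) = ω(u₀)·ω(1 + c(u₁∕u₀ − 1))`, `c = r∕(1+r)` (the `0 ↔ 1` mirror of ★ R3 FILE 3's `λ_c`; `π₀^ρ = N(ϖ^ρ)` has left `ω`).
[cite: Rogawski1990, §4.9 Prop. 4.9.1 (b) p. 55] [cite: Serre1979, Ch. V §3 Cor. 3; Ch. XV §2] [cite: LanglandsShelstad1987, §3] [cite: Kottwitz1986BaseChangeUnits, §1 pp. 240–241] -/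
theorem valueClassLabel_glued_rep_class_kappaLocus_iff_character [Finite 𝓀[K]] (hDat : IsRamifiedQuadraticDatum σ ϖ d t) (h2d : 2 ≤ d)
    {ρ t' : ℕ} (hρ : 1 ≤ ρ) (ht' : 1 ≤ t') {g : K} (hσg : σ g = g) (hg : Valued.v g = Valued.v ϖ ^ (2 * t'))
    (V : GL (Fin 3) K) (hV : (V : Matrix (Fin 3) (Fin 3) K) = !![1, 0, 0; 1, ϖ ^ ρ, 0; 1 * 1 + g, ϖ ^ ρ * 1, ϖ ^ (2 * ρ + 2 * t')])
    {u : Fin 3 → Kˣ} (hu : u ∈ fixedUnitTorus σ 3) (hu10 : Valued.v (((u 1 : Kˣ) : K) / ((u 0 : Kˣ) : K) - 1) ≤ Valued.v ϖ ^ ρ)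
    (hn : IsNormalisedLattice (latt (V : Matrix (Fin 3) (Fin 3) K)))
    (hM : IsVertexLattice σ ϖ (Matrix.diagonal fun j => (![((ϖ * σ ϖ) ^ (ρ + t'))⁻¹ * g, ((ϖ * σ ϖ) ^ (ρ + t'))⁻¹, -(((ϖ * σ ϖ) ^ (ρ + t'))⁻¹ * (1 + g)⁻¹)] : Fin 3 → K) j *
      ((u j : Kˣ) : K)) 0 (latt (V : Matrix (Fin 3) (Fin 3) K)))
    (hE : IsElementDatum σ ϖ N₀ α β n₁ n₂ n₃) (hmc : mcOfRecord d ≤ N₀)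
    (hlev : LatticeInLevel ϖ (d % 2) (Matrix.diagonal ![α - 1, β - 1, 0]) (latt (V : Matrix (Fin 3) (Fin 3) K)))
    (hnlev : ¬ LatticeInLevel ϖ (d % 2 + 1) (Matrix.diagonal ![α - 1, β - 1, 0]) (latt (V : Matrix (Fin 3) (Fin 3) K)))
    (hsq : LatticeInLevel ϖ (mcOfRecord d) (Matrix.diagonal ![(α - 1) * (α - 1), (β - 1) * (β - 1), 0]) (latt (V : Matrix (Fin 3) (Fin 3) K)))
    {T : GL (Fin 3) K} (hT : (T : Matrix (Fin 3) (Fin 3) K) = Matrix.diagonal ![α, β, 1]) (hTM : mapGL T (latt (V : Matrix (Fin 3) (Fin 3) K)) = latt (V : Matrix (Fin 3) (Fin 3) K))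
    (hκ : 2 * ρ + d % 2 = n₂) (k : ℕ) (hk : 1 ≤ k) (hk₁ : 2 * (ρ + t' + k) + d % 2 = n₁)
    {eA : K} (hσeA : σ eA = eA) (heA1 : Valued.v eA = 1)
    (heA : Valued.v ((ϖ ^ (d % 2 + 2 * d - 1))⁻¹ * ((α - 1) * ((ϖ * σ ϖ) ^ ρ)⁻¹ - eA * ((ϖ - σ ϖ) * ((ϖ * σ ϖ) ^ ((d - d % 2) / 2))⁻¹))) ≤ 1)
    {eB : K} (hσeB : σ eB = eB) (heB1 : Valued.v eB = 1)
    (heB : Valued.v ((ϖ ^ (d % 2 + 2 * d - 1))⁻¹ * ((β - 1) * ((ϖ * σ ϖ) ^ (ρ + t' + k))⁻¹ - eB * ((ϖ - σ ϖ) * ((ϖ * σ ϖ) ^ ((d - d % 2) / 2))⁻¹))) ≤ 1) :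
    valueClassLabel σ ϖ (α - 1) (β - 1) (d % 2 + 2 * d - 1) d (latt (V : Matrix (Fin 3) (Fin 3) K))
        (fun j => (![((ϖ * σ ϖ) ^ (ρ + t'))⁻¹ * g, ((ϖ * σ ϖ) ^ (ρ + t'))⁻¹, -(((ϖ * σ ϖ) ^ (ρ + t'))⁻¹ * (1 + g)⁻¹)] : Fin 3 → K) j * ((u j : Kˣ) : K)) ↔
      normSign σ (g * eA * (1 + eB * (ϖ * σ ϖ) ^ (t' + k) / (g * eA))) *
          (normSign σ ((u 0 : Kˣ) : K) *
            normSign σ (1 + (eB * (ϖ * σ ϖ) ^ (t' + k) / (g * eA)) / (1 + eB * (ϖ * σ ϖ) ^ (t' + k) / (g * eA)) * (((u 1 : Kˣ) : K) / ((u 0 : Kˣ) : K) - 1))) = 1 := by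
  obtain ⟨hσ, hvσ, hϖ, -, -, -, -⟩ := id hDat
  obtain ⟨huv, huσ⟩ := (mem_fixedUnitTorus_iff σ u).1 hu
  have hϖ0 : ϖ ≠ 0 := (Valuation.ne_zero_iff Valued.v).1 (by rw [hϖ]; exact exp_ne_zero)
  have hϖ1 : Valued.v ϖ < 1 := by rw [hϖ, ← exp_zero, exp_lt_exp]; norm_num
  have hσϖ0 : σ ϖ ≠ 0 := (map_ne_zero σ).2 hϖ0
  have hg0 : g ≠ 0 := fun h => by
    rw [h, map_zero] at hg; exact (pow_ne_zero _ ((Valuation.ne_zero_iff _).2 hϖ0)) hg.symm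
  have heA0 : eA ≠ 0 := fun h => by rw [h, map_zero] at heA1; exact zero_ne_one heA1
  have hπ₀σ : σ (ϖ * σ ϖ) = ϖ * σ ϖ := by rw [map_mul, hσ, mul_comm]
  have hπσ : ∀ m : ℕ, σ ((ϖ * σ ϖ) ^ m) = (ϖ * σ ϖ) ^ m := fun m => by rw [map_pow, hπ₀σ]
  have hπne : ∀ m : ℕ, ((ϖ * σ ϖ) ^ m : K) ≠ 0 := fun m => pow_ne_zero _ (mul_ne_zero hϖ0 hσϖ0)
  have hvπ : ∀ m : ℕ, Valued.v ((ϖ * σ ϖ) ^ m) = exp (-((2 * m : ℕ) : ℤ)) := fun m => by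
    rw [map_pow, map_mul, hvσ, ← pow_two, ← pow_mul, v_varpi_pow hϖ]
  have hq : ∀ m : ℕ, Valued.v ϖ ^ m = exp (-(m : ℤ)) := fun m => v_varpi_pow hϖ m
  -- the linear read of `valueClassLabel_glued_rep_class_kappaLocus_iff`
  have hlin := valueClassLabel_glued_rep_class_kappaLocus_iff hDat h2d hρ ht' hσg hg V hV (u := fun j => ((u j : Kˣ) : K)) huσ (fun j => (u j).ne_zero) huv
    hn hM hE hmc hlev hnlev hsq hT hTM hκ k hk hk₁ hσeA heA hσeB heB
  rw [hlin]
  -- `G₀ = g·e_A·π₀^ρ`, `r = e_B·π₀^{t′+k}∕(g·e_A)`: `u₁·e_B·π₀^{ρ+t′+k} = u₁·(r·G₀)`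
  set r : K := eB * (ϖ * σ ϖ) ^ (t' + k) / (g * eA) with hrdef
  have hG₀σ : σ (g * (eA * (ϖ * σ ϖ) ^ ρ)) = g * (eA * (ϖ * σ ϖ) ^ ρ) := by rw [map_mul, map_mul, hσg, hσeA, hπσ]
  have hG₀0 : g * (eA * (ϖ * σ ϖ) ^ ρ) ≠ 0 := mul_ne_zero hg0 (mul_ne_zero heA0 (hπne ρ))
  have hσr : σ r = r := by rw [hrdef, map_div₀, map_mul, map_mul, hσeB, hπσ, hσg, hσeA]
  have hvr : Valued.v r = Valued.v ϖ ^ (2 * k) := by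
    rw [hrdef, map_div₀, map_mul, map_mul, heB1, one_mul, hvπ, hg, heA1, mul_one, hq, hq, ← exp_sub]
    congr 1; push_cast; ring
  have hrlt : Valued.v r < 1 := by rw [hvr]; exact pow_lt_one₀ zero_le hϖ1 (by omega)
  have h1r : Valued.v (1 + r) = 1 := Valued.v.map_one_add_of_lt hrlt
  have hcv : Valued.v (r / (1 + r) * (((u 1 : Kˣ) : K) / ((u 0 : Kˣ) : K) - 1)) < 1 := by
    rw [map_mul, map_div₀, h1r, div_one]
    calc Valued.v r * Valued.v (((u 1 : Kˣ) : K) / ((u 0 : Kˣ) : K) - 1) ≤ Valued.v r * Valued.v ϖ ^ ρ := mul_le_mul' le_rfl hu10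
      _ < 1 * 1 := mul_lt_mul'' hrlt (pow_lt_one₀ zero_le hϖ1 (by omega)) zero_le zero_le
      _ = 1 := one_mul 1
  have hrG : r * (g * (eA * (ϖ * σ ϖ) ^ ρ)) = eB * (ϖ * σ ϖ) ^ (ρ + t' + k) := by
    rw [hrdef, div_mul_eq_mul_div, div_eq_iff (mul_ne_zero hg0 heA0)]; ring
  have hrew : ((u 0 : Kˣ) : K) * g * (eA * (ϖ * σ ϖ) ^ ρ) + ((u 1 : Kˣ) : K) * (eB * (ϖ * σ ϖ) ^ (ρ + t' + k)) =
      ((u 0 : Kˣ) : K) * (g * (eA * (ϖ * σ ϖ) ^ ρ)) + ((u 1 : Kˣ) : K) * (r * (g * (eA * (ϖ * σ ϖ) ^ ρ))) := by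
    rw [hrG]; ring
  rw [hrew, normSign_twoSlot_factor_fst hDat hG₀σ hσr hG₀0 hrlt hu hcv]
  -- `π₀^ρ = N(ϖ^ρ)` leaves `ω`
  have hnorm : g * (eA * (ϖ * σ ϖ) ^ ρ) * (1 + r) = (g * eA * (1 + r)) * (ϖ ^ ρ * σ (ϖ ^ ρ)) := by rw [map_pow, ← mul_pow]; ring
  rw [hnorm, normSign_mul_norm σ _ (pow_ne_zero ρ hϖ0)]

end KappaLocus

end Summit.HodgeConjecture.HodgeConjecture.Cruxes.H413.F0P3cDyRamLabelledOddKappaClassGluedRep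

end
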